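import Literature.Algebra.Homology.LaurentCechFreeTwistsDualityPairing
import Literature.Algebra.Homology.LaurentCechGradedModuleStructure
import HarnessLib

/-!
# Serre duality on `ℙ^r_A` is functorial for homomorphisms of split bundles

Hartshorne, *Algebraic Geometry*, III Thm. 7.1 (Duality for `ℙ^n_k`) (c): "for every `i ≥ 0` there
is a natural functorial isomorphism `Ext^i(𝓕, ω) ≅ H^{n-i}(X, 𝓕)'`" — FUNCTORIAL in the
coherent sheaf `𝓕`; for a locally free `𝓕` this is Cor. 7.7 "there are natural isomorphisms
`H^i(X, 𝓕) ≅ H^{n-i}(X, 𝓕^∨ ⊗ ω_X°)'`" (`Ext^i(𝓕, ω) = H^i(X, 𝓕^∨ ⊗ ω)` by III Prop. 6.3 / 6.7).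
The companion file `Literature/Algebra/Homology/LaurentCechSerreDuality` constructs these
isomorphisms for `X = ℙ^r_A` (any commutative ring `A`, `r ≥ 1`) and the split bundles
`𝓕 = ⊕_{j ∈ J} 𝒪(d - e_j)`, characterised in the two non-trivial degrees `0` and `r` as the
adjoints of the natural pairing of Thm. 7.1 (b). This file proves the functoriality, in the tree's
Čech language (`Literature/Algebra/Homology/LaurentCech*`).

A homomorphism of split bundles `M : ⊕_j 𝒪(d - e_j) → ⊕_{j'} 𝒪(d' - e'_{j'})` is a matrix of
homogeneous polynomials `q_{j'j} ∈ P_{(d' - e'_{j'}) - (d - e_j)}`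
(`Hom(𝒪(a), 𝒪(b)) = H⁰(𝒪(b - a)) = P_{b-a}`, Görtz–Wedhorn II Thm. 22.22 (2) / Hartshorne II
Prop. 5.13), and its `ω`-twisted dual `M^∨ ⊗ ω : ⊕_{j'} 𝒪(-(d' - e'_{j'}) - r - 1) →
⊕_j 𝒪(-(d - e_j) - r - 1)` is the TRANSPOSED matrix:

* `LaurentCech.matVec q`, **`LaurentCech.matMap e e' q hq d d' h : Č_d(F_e) ⟶ Č_{d'}(F_{e'})`** —
  the cochain map of the homomorphism `(q_{j'j})`, `v ↦ (Σ_j q_{j'j} v_j)_{j'}`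
  (`OrderedCech.complexMap`); `matMap_comp` (matrix product = composition), the row maps
  `rowMap` of `LaurentCechFreeTwistsDualityPairing` are the case `J' = Unit`
  (`rowMap_eq_matMap`, `matMap_comp_rowMap`);
* **`LaurentCech.coe_globalSectionsEquivFree_homologyMap_matMap`** — on `H⁰` the induced map IS
  the matrix acting on vectors of homogeneous polynomials
  (`globalSectionsEquivFree (H⁰(M) ξ) = q · globalSectionsEquivFree ξ`), via the naturality of
  the vertex section `sec` (`sec_homologyMap_matMap`);
* **`LaurentCech.dualPairing_homologyMap_matMap`** — the natural pairing of Thm. 7.1 (b) is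
  natural: `⟨g, H^i(M) ξ⟩ = ⟨g ∘ M, ξ⟩` for `g ∈ Hom(⊕_{j'} 𝒪(d' - e'_{j'}), 𝒪(d₀))` (a row),
  `g ∘ M` the row `(Σ_{j'} g_{j'} q_{j'j})_j`;
* **`LaurentCech.serreDuality_top_naturality`** — degree `r`: for the duality isomorphisms
  `Φ_𝓕 : H^r(Č_d(F_e)) ≃ Dual_A H⁰(𝓕^∨ ⊗ ω)` and `Φ_{𝓕'}` (ANY maps satisfying the adjoint
  formula of `LaurentCechSerreDuality.exists_linearEquiv_dual_top`, for one fixed `ε`),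
  `Φ_{𝓕'} (H^r(M) ξ) (η') = Φ_𝓕 (ξ) (H⁰(M^∨ ⊗ ω) η')` — the square of Cor. 7.7 commutes, the
  dual side being the transpose `H⁰(Mᵗ)`;
* **`LaurentCech.serreDuality_zero_naturality`** — degree `0`:
  `Φ⁰_{𝓕'} (H⁰(M) ξ) (η̃') = Φ⁰_𝓕 (ξ) (H^r(M^∨ ⊗ ω) η̃')`;
* the line-bundle case (`J = J' = Unit`, a homomorphism `𝒪(c) → 𝒪(c + a)` = a homogeneous
  polynomial `p` of degree `a`, acting by `mulPairing` of `LaurentCechTopCohomologyPerfectPairing`):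
  **`serreDuality_twist_top_naturality`**, **`serreDuality_twist_zero_naturality`**
  `Φ' (p · ξ) η' = Φ ξ (p · η')` for the cup-product characterised isomorphisms of
  `LaurentCechSerreDuality.exists_linearEquiv_dual_twist_top/_zero` (Görtz–Wedhorn Cor. 22.23 (∗)).

In the remaining degrees both sides of the duality vanish and there is nothing to prove. All proofs
are functoriality of `HomologicalComplex.homologyMap` plus the matrix identities
`row(g) ∘ M = row(g · M)`; everything is proved, no named facts; definitions with bodies
(`matVec`, `matMap`). Not here: general coherent `𝓕` (Thm. 7.1 (c) proper needs `Ext`).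

## References
* [Hartshorne1977] R. Hartshorne, *Algebraic Geometry*, GTM 52 (1977), III Thm. 7.1 (c) and its
  proof (pp. 239–240), III Cor. 7.7 (p. 244).
* [GortzWedhorn2023] U. Görtz, T. Wedhorn, *Algebraic Geometry II* (2023), Thm. 22.22 (2),
  Cor. 22.23 (pp. 339–340).
-/

noncomputable section

open CategoryTheory CategoryTheory.Limits Finset

universe u

namespace Literature.Algebra.Homology

namespace LaurentCech

open OrderedCech

variable {A : Type u} [CommRing A] {r : ℕ} {J J' J'' : Type}
  (e : J → ℤ) (e' : J' → ℤ) (e'' : J'' → ℤ)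

/-! ### Matrices of homogeneous polynomials: homomorphisms of split bundles -/

section Mat

variable [Fintype J]

/-- The matrix map `v ↦ (Σ_j toL(q_{j'j}) v_j)_{j'} : L^J → L^{J'}` of a matrix of polynomials
`(q_{j'j})` — on sections over the torus, the sheaf homomorphism
`(q_{j'j}) : ⊕_j 𝒪(d - e_j) → ⊕_{j'} 𝒪(d' - e'_{j'})`.
[cite: Hartshorne1977, III Thm. 7.1 (c) (pp. 239–240)] -/
def matVec (q : J' → J → P A r) : (J → L A r) →ₗ[A] (J' → L A r) where
  toFun v j' := ∑ j, toL A r (q j' j) * v j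
  map_add' v w := by
    funext j'
    simp only [Pi.add_apply, mul_add, Finset.sum_add_distrib]
  map_smul' a v := by
    funext j'
    simp only [Pi.smul_apply, RingHom.id_apply, Finset.smul_sum, mul_smul_comm]

/-- `matVec q v j' = Σ_j toL(q_{j'j}) v_j`. [cite: Hartshorne1977, III Thm. 7.1 (c) (pp. 239–240)] -/
@[simp] theorem matVec_apply (q : J' → J → P A r) (v : J → L A r) (j' : J') :
    matVec q v j' = ∑ j, toL A r (q j' j) * v j := rfl

/-- The matrix map sends the sections `(F_{e,s})_d` of `⊕_j 𝒪(d - e_j)` over `U_s` into the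
sections `(F_{e',s})_{d'}` of `⊕_{j'} 𝒪(d' - e'_{j'})` when `q_{j'j}` is homogeneous of degree
`c_{j'j}` with `(d - e_j) + c_{j'j} = d' - e'_{j'}` (a homomorphism `𝒪(a) → 𝒪(b)` is a
homogeneous polynomial of degree `b - a`).
[cite: Hartshorne1977, III Thm. 7.1 (c) (pp. 239–240)] [cite: GortzWedhorn2023, Thm. 22.22 (2)] -/
theorem matVec_mem_locDeg {c : J' → J → ℤ} {q : J' → J → P A r}
    (hq : ∀ j' j, toL A r (q j' j) ∈ Ldeg A r (c j' j)) {d d' : ℤ}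
    (h : ∀ j' j, d - e j + c j' j = d' - e' j') {s : Finset (Fin (r + 1))} {v : J → L A r}
    (hv : v ∈ locDeg e (⊤ : Submodule (P A r) (J → P A r)) s d) :
    matVec q v ∈ locDeg e' (⊤ : Submodule (P A r) (J' → P A r)) s d' := by
  rw [mem_locDeg] at hv ⊢
  obtain ⟨hloc, hdeg⟩ := hv
  constructor
  · obtain ⟨N, k, -, hk⟩ := hloc
    refine ⟨N, fun j' => ∑ j, q j' j * k j, Submodule.mem_top, ?_⟩
    funext j'
    rw [Pi.smul_apply, matVec_apply, ιK_apply, map_sum, smul_eq_mul, Finset.mul_sum]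
    refine Finset.sum_congr rfl fun j _ => ?_
    have hj : xs A s N * v j = toL A r (k j) := by
      have := congr_fun hk j
      rwa [Pi.smul_apply, smul_eq_mul, ιK_apply] at this
    rw [map_mul, ← hj]
    ring
  · rw [mem_Kdeg] at hdeg ⊢
    intro j'
    rw [matVec_apply]
    refine Submodule.sum_mem _ fun j _ => ?_
    have := mul_mem_Ldeg (hq j' j) (hdeg j)
    rwa [show c j' j + (d - e j) = d' - e' j' by rw [← h j' j]; ring] at this

/-- **The cochain map of the homomorphism `(q_{j'j}) : ⊕_j 𝒪(d - e_j) → ⊕_{j'} 𝒪(d' - e'_{j'})`**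
given by a matrix of homogeneous polynomials of degrees `c_{j'j} = (d' - e'_{j'}) - (d - e_j)`:
`Č_d(F_e) ⟶ Č_{d'}(F_{e'})` (`OrderedCech.complexMap` of `matVec`).
[cite: Hartshorne1977, III Thm. 7.1 (c) (pp. 239–240)] -/
def matMap {c : J' → J → ℤ} (q : J' → J → P A r)
    (hq : ∀ j' j, toL A r (q j' j) ∈ Ldeg A r (c j' j)) (d d' : ℤ)
    (h : ∀ j' j, d - e j + c j' j = d' - e' j') :
    cech e (⊤ : Submodule (P A r) (J → P A r)) d ⟶
      cech e' (⊤ : Submodule (P A r) (J' → P A r)) d' :=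
  complexMap (matVec q) (fun _ _ hv => matVec_mem_locDeg e e' hq h hv)
    (locDeg_mono e ⊤ d) (locDeg_mono e' ⊤ d')

/-- The components of `matMap`. [cite: Hartshorne1977, III Thm. 7.1 (c) (pp. 239–240)] -/
theorem matMap_f {c : J' → J → ℤ} (q : J' → J → P A r)
    (hq : ∀ j' j, toL A r (q j' j) ∈ Ldeg A r (c j' j)) (d d' : ℤ)
    (h : ∀ j' j, d - e j + c j' j = d' - e' j') (n : ℤ) :
    (matMap e e' q hq d d' h).f n = ModuleCat.ofHom
      (Cochain.map (matVec q) (fun _ _ hv => matVec_mem_locDeg e e' hq h hv) n) :=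
  rfl

/-- **The matrix map on cochains**: `((q) · x)_σ,j' = Σ_j toL(q_{j'j}) (x_σ)_j`.
[cite: Hartshorne1977, III Thm. 7.1 (c) (pp. 239–240)] -/
theorem matMap_f_apply_coe {c : J' → J → ℤ} (q : J' → J → P A r)
    (hq : ∀ j' j, toL A r (q j' j) ∈ Ldeg A r (c j' j)) (d d' : ℤ)
    (h : ∀ j' j, d - e j + c j' j = d' - e' j') (n : ℤ)
    (x : (cech e (⊤ : Submodule (P A r) (J → P A r)) d).X n) (σ : Simplex (Fin (r + 1)) n)
    (j' : J') :
    ((((matMap e e' q hq d d' h).f n).hom x : Cochain (fun s => locDeg e'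
        (⊤ : Submodule (P A r) (J' → P A r)) s d') n) σ : J' → L A r) j' =
      ∑ j, toL A r (q j' j) *
        ((x : Cochain (fun s => locDeg e (⊤ : Submodule (P A r) (J → P A r)) s d) n) σ :
          J → L A r) j :=
  rfl

/-- **Composition of homomorphisms is the matrix product**: for matrices `q₁ : F_e(d) → F_{e'}(d')`,
`q₂ : F_{e'}(d') → F_{e''}(d'')` and `q₃ = q₂ q₁` (entrywise `q₃_{j''j} = Σ_{j'} q₂_{j''j'} q₁_{j'j}`),
`matMap q₃ = matMap q₁ ≫ matMap q₂`. [cite: Hartshorne1977, III Thm. 7.1 (c) (pp. 239–240)] -/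
theorem matMap_comp [Fintype J'] {c₁ : J' → J → ℤ} {c₂ : J'' → J' → ℤ} {c₃ : J'' → J → ℤ}
    (q₁ : J' → J → P A r) (hq₁ : ∀ j' j, toL A r (q₁ j' j) ∈ Ldeg A r (c₁ j' j))
    (q₂ : J'' → J' → P A r) (hq₂ : ∀ j'' j', toL A r (q₂ j'' j') ∈ Ldeg A r (c₂ j'' j'))
    (q₃ : J'' → J → P A r) (hq₃ : ∀ j'' j, toL A r (q₃ j'' j) ∈ Ldeg A r (c₃ j'' j))
    (hmul : ∀ j'' j, q₃ j'' j = ∑ j', q₂ j'' j' * q₁ j' j) {d d' d'' : ℤ}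
    (h₁ : ∀ j' j, d - e j + c₁ j' j = d' - e' j')
    (h₂ : ∀ j'' j', d' - e' j' + c₂ j'' j' = d'' - e'' j'')
    (h₃ : ∀ j'' j, d - e j + c₃ j'' j = d'' - e'' j'') :
    matMap e e'' q₃ hq₃ d d'' h₃ = matMap e e' q₁ hq₁ d d' h₁ ≫ matMap e' e'' q₂ hq₂ d' d'' h₂ := by
  ext n x
  rw [HomologicalComplex.comp_f, ModuleCat.comp_apply]
  simp only [matMap_f]
  funext σ
  apply Subtype.ext
  change matVec q₃ _ = matVec q₂ (matVec q₁ _)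
  funext j''
  simp only [matVec_apply, hmul, map_sum, map_mul, Finset.sum_mul, Finset.mul_sum, mul_assoc]
  exact Finset.sum_comm

/-- The row maps `rowMap` (homomorphisms `⊕_j 𝒪(d - e_j) → 𝒪(d')`) are the matrix maps with one
row (`J' = Unit`). [cite: Hartshorne1977, III Thm. 7.1 (b) (pp. 239–240)] -/
theorem rowMap_eq_matMap {c : J → ℤ} (q : J → P A r) (hq : ∀ j, toL A r (q j) ∈ Ldeg A r (c j))
    (d d' : ℤ) (h : ∀ j, d - e j + c j = d') :
    rowMap e q hq d d' h = matMap e (fun _ : Unit => (0 : ℤ)) (fun _ j => q j) (fun _ j => hq j)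
      d d' (fun _ j => by rw [sub_zero]; exact h j) := by
  ext n x
  simp only [rowMap_f, matMap_f]
  rfl

omit [Fintype J] in
/-- Membership of the entries of a row-times-matrix product: `Σ_{j'} g_{j'} q_{j'j}` is homogeneous
of degree `c''_j = c'_{j'} + c_{j'j}`. [cite: GortzWedhorn2023, Thm. 22.22 (2)] -/
theorem toL_sum_mul_mem_Ldeg [Fintype J'] {c' : J' → ℤ} {c : J' → J → ℤ} {c'' : J → ℤ}
    (hc : ∀ j' j, c' j' + c j' j = c'' j) (g : HomVec A r c') (q : J' → J → P A r)
    (hq : ∀ j' j, toL A r (q j' j) ∈ Ldeg A r (c j' j)) (j : J) :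
    toL A r (∑ j', (g j').1 * q j' j) ∈ Ldeg A r (c'' j) := by
  rw [map_sum]
  refine Submodule.sum_mem _ fun j' _ => ?_
  have := toL_mul_mem_Ldeg (g j').2 (hq j' j)
  rwa [hc j' j] at this

/-- **A row composed with a matrix is the product row**: `matMap q ≫ rowMap g = rowMap (g · q)`,
`(g · q)_j = Σ_{j'} g_{j'} q_{j'j}` — the homomorphism `g ∘ M : ⊕_j 𝒪(d - e_j) → 𝒪(d₀)`.
[cite: Hartshorne1977, III Thm. 7.1 (c) (pp. 239–240)] -/
theorem matMap_comp_rowMap [Fintype J'] {c : J' → J → ℤ} (q : J' → J → P A r)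
    (hq : ∀ j' j, toL A r (q j' j) ∈ Ldeg A r (c j' j)) {d d' : ℤ}
    (h : ∀ j' j, d - e j + c j' j = d' - e' j') {c' : J' → ℤ} {d₀ : ℤ}
    (h' : ∀ j', d' - e' j' + c' j' = d₀) (g : HomVec A r c') {c'' : J → ℤ}
    (hc : ∀ j' j, c' j' + c j' j = c'' j) (h'' : ∀ j, d - e j + c'' j = d₀) :
    matMap e e' q hq d d' h ≫ rowMap e' (fun j' => (g j').1) (fun j' => (g j').2) d' d₀ h' =
      rowMap e (fun j => ∑ j', (g j').1 * q j' j) (toL_sum_mul_mem_Ldeg hc g q hq) d d₀ h'' := by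
  ext n x
  rw [HomologicalComplex.comp_f, ModuleCat.comp_apply]
  simp only [matMap_f, rowMap_f]
  funext σ
  apply Subtype.ext
  change rowVec _ (matVec q _) = rowVec _ _
  funext u
  simp only [rowVec_apply, matVec_apply, map_sum, map_mul, Finset.sum_mul, Finset.mul_sum,
    mul_assoc]
  exact Finset.sum_comm

end Mat

/-! ### `H⁰(M)` is the matrix acting on vectors of homogeneous polynomials -/

section HZero

variable [Fintype J]

/-- **Naturality of the vertex section**: `sec (H⁰(M) ξ) = M · sec ξ` for the matrix map `M`
(`homologyπ_naturality`, `cyclesMap_i`). [cite: GortzWedhorn2023, Lemma 21.65 (p. 259)] -/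
theorem sec_homologyMap_matMap {c : J' → J → ℤ} (q : J' → J → P A r)
    (hq : ∀ j' j, toL A r (q j' j) ∈ Ldeg A r (c j' j)) {d d' : ℤ}
    (h : ∀ j' j, d - e j + c j' j = d' - e' j')
    (ξ : (cech e (⊤ : Submodule (P A r) (J → P A r)) d).homology 0) :
    sec e' ⊤ d' ((HomologicalComplex.homologyMap (matMap e e' q hq d d' h) 0).hom ξ) =
      matVec q (sec e ⊤ d ξ) := by
  obtain ⟨z, rfl⟩ := homologyπ_zero_surjective e ⊤ d ξ
  rw [← ModuleCat.comp_apply, HomologicalComplex.homologyπ_naturality,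
    ModuleCat.comp_apply, sec_homologyπ _ _ _ _ 0, sec_homologyπ _ _ _ _ 0,
    ← ModuleCat.comp_apply, HomologicalComplex.cyclesMap_i, ModuleCat.comp_apply]
  rfl

/-- **On global sections the induced map is the matrix**: the `j'`-th polynomial of
`globalSectionsEquivFree (H⁰(M) ξ)` is `Σ_j q_{j'j} ·` the `j`-th polynomial of
`globalSectionsEquivFree ξ` — `H⁰(⊕_j 𝒪(d - e_j)) = ⊕_j P_{d - e_j}` functorially (`r ≥ 1`).
[cite: GortzWedhorn2023, Thm. 22.22 (2)] [cite: Hartshorne1977, III Thm. 7.1 (c) (pp. 239–240)] -/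
theorem coe_globalSectionsEquivFree_homologyMap_matMap [Finite J'] (hr : 1 ≤ r) {c : J' → J → ℤ}
    (q : J' → J → P A r) (hq : ∀ j' j, toL A r (q j' j) ∈ Ldeg A r (c j' j)) {d d' : ℤ}
    (h : ∀ j' j, d - e j + c j' j = d' - e' j')
    (ξ : (cech e (⊤ : Submodule (P A r) (J → P A r)) d).homology 0) (j' : J') :
    (globalSectionsEquivFree (A := A) e' hr d'
        ((HomologicalComplex.homologyMap (matMap e e' q hq d d' h) 0).hom ξ) j').1 =
      ∑ j, q j' j * (globalSectionsEquivFree (A := A) e hr d ξ j).1 := by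
  apply toL_injective
  have h1 := congr_fun (ιK_globalSectionsEquivFree e' hr d'
    ((HomologicalComplex.homologyMap (matMap e e' q hq d d' h) 0).hom ξ)) j'
  rw [ιK_apply] at h1
  rw [h1, sec_homologyMap_matMap, matVec_apply, map_sum]
  refine Finset.sum_congr rfl fun j _ => ?_
  have h2 := congr_fun (ιK_globalSectionsEquivFree e hr d ξ) j
  rw [ιK_apply] at h2
  rw [map_mul, h2]

end HZero

/-! ### The natural pairing of Thm. 7.1 (b) is natural in `𝓕` -/

section PairingNaturality

variable [Fintype J] [Fintype J']

/-- **`⟨g, H^i(M) ξ⟩ = ⟨g ∘ M, ξ⟩`**: for a homomorphism `M = (q_{j'j}) : ⊕_j 𝒪(d - e_j) →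
⊕_{j'} 𝒪(d' - e'_{j'})`, a row `g = (g_{j'}) ∈ Hom(⊕_{j'} 𝒪(d' - e'_{j'}), 𝒪(d₀))` and
`ξ ∈ H^i(Č_d(F_e))`, the natural pairing satisfies
`dualPairing g (H^i(M) ξ) = dualPairing (g · q) ξ` — functoriality of `H^i`
(`homologyMap_comp`) and `matMap_comp_rowMap`.
[cite: Hartshorne1977, III Thm. 7.1 (c) (pp. 239–240)] -/
theorem dualPairing_homologyMap_matMap (i : ℤ) {c : J' → J → ℤ} (q : J' → J → P A r)
    (hq : ∀ j' j, toL A r (q j' j) ∈ Ldeg A r (c j' j)) {d d' : ℤ}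
    (h : ∀ j' j, d - e j + c j' j = d' - e' j') {c' : J' → ℤ} {d₀ : ℤ}
    (h' : ∀ j', d' - e' j' + c' j' = d₀) (g : HomVec A r c') {c'' : J → ℤ}
    (hc : ∀ j' j, c' j' + c j' j = c'' j) (h'' : ∀ j, d - e j + c'' j = d₀)
    (ξ : (cech e (⊤ : Submodule (P A r) (J → P A r)) d).homology i) :
    dualPairing e' i c' d' d₀ h' g
        ((HomologicalComplex.homologyMap (matMap e e' q hq d d' h) i).hom ξ) =
      dualPairing e i c'' d d₀ h''
        (fun j => ⟨∑ j', (g j').1 * q j' j, toL_sum_mul_mem_Ldeg hc g q hq j⟩) ξ := by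
  rw [dualPairing_apply, dualPairing_apply, ← ModuleCat.comp_apply,
    ← HomologicalComplex.homologyMap_comp]
  have hm := matMap_comp_rowMap e e' q hq h h' g hc h''
  change (HomologicalComplex.homologyMap (matMap e e' q hq d d' h ≫
    rowMap e' (fun j' => (g j').1) (fun j' => (g j').2) d' d₀ h') i).hom ξ = _
  rw [hm]

end PairingNaturality

/-! ### Naturality of the Serre duality isomorphisms (degrees `r` and `0`) -/

section Naturality

variable [Fintype J] [Fintype J'] (eD : J → ℤ) (eD' : J' → ℤ)

omit [Fintype J] [Fintype J'] in
/-- The degree bookkeeping of the transpose: if `M = (q_{j'j})` maps `⊕_j 𝒪(d - e_j)` to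
`⊕_{j'} 𝒪(d' - e'_{j'})` and `⊕_j 𝒪(dD - eD_j)`, `⊕_{j'} 𝒪(dD' - eD'_{j'})` are the `ω`-twisted
duals (`(d - e_j) + (dD - eD_j) = -r-1`, `(d' - e'_{j'}) + (dD' - eD'_{j'}) = -r-1`), then the
transposed matrix maps `⊕_{j'} 𝒪(dD' - eD'_{j'})` to `⊕_j 𝒪(dD - eD_j)`.
[cite: Hartshorne1977, III Cor. 7.7 (p. 244)] -/
theorem transpose_degree_cond {c : J' → J → ℤ} {d d' dD dD' : ℤ}
    (h : ∀ j' j, d - e j + c j' j = d' - e' j')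
    (hd : ∀ j, d - e j + (dD - eD j) = -(r + 1 : ℤ))
    (hd' : ∀ j', d' - e' j' + (dD' - eD' j') = -(r + 1 : ℤ)) :
    ∀ j j', dD' - eD' j' + c j' j = dD - eD j := fun j j' => by
  have h1 := h j' j; have h2 := hd j; have h3 := hd' j'; omega

omit [Fintype J] [Fintype J'] in
/-- The same bookkeeping with the dual relations written the other way round (the shape consumed
in degree `0`). [cite: Hartshorne1977, III Cor. 7.7 (p. 244)] -/
theorem transpose_degree_cond' {c : J' → J → ℤ} {d d' dD dD' : ℤ}
    (h : ∀ j' j, d - e j + c j' j = d' - e' j')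
    (hd : ∀ j, dD - eD j + (d - e j) = -(r + 1 : ℤ))
    (hd' : ∀ j', dD' - eD' j' + (d' - e' j') = -(r + 1 : ℤ)) :
    ∀ j j', dD' - eD' j' + c j' j = dD - eD j := fun j j' => by
  have h1 := h j' j; have h2 := hd j; have h3 := hd' j'; omega

/-- **Serre duality in degree `r` is natural** (Hartshorne III Thm. 7.1 (c) "natural functorial
isomorphism", Cor. 7.7, for `X = ℙ^r_A` and split bundles): let `M = (q_{j'j}) : 𝓕 = ⊕_j 𝒪(d - e_j)
→ 𝓕' = ⊕_{j'} 𝒪(d' - e'_{j'})`, let `⊕_j 𝒪(dD - eD_j) = 𝓕^∨ ⊗ ω` and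
`⊕_{j'} 𝒪(dD' - eD'_{j'}) = 𝓕'^∨ ⊗ ω`, fix `ε : H^r(Č_{-r-1}(P)) ≃ A`, and let `Φ`, `Φ'` be the
duality isomorphisms `H^r(𝓕) ≃ Dual_A H⁰(𝓕^∨ ⊗ ω)`, `H^r(𝓕') ≃ Dual_A H⁰(𝓕'^∨ ⊗ ω)`
characterised by the adjoint formulas of `LaurentCechSerreDuality.exists_linearEquiv_dual_top`.
Then for all `ξ ∈ H^r(𝓕)`, `η' ∈ H⁰(𝓕'^∨ ⊗ ω)`:
`Φ' (H^r(M) ξ) η' = Φ ξ (H⁰(Mᵗ) η')`, `Mᵗ = M^∨ ⊗ ω` the transposed matrix.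
[cite: Hartshorne1977, III Thm. 7.1 (c) (pp. 239–240)] [cite: Hartshorne1977, III Cor. 7.7 (p. 244)] -/
theorem serreDuality_top_naturality (hr : 1 ≤ r) {c : J' → J → ℤ} (q : J' → J → P A r)
    (hq : ∀ j' j, toL A r (q j' j) ∈ Ldeg A r (c j' j)) {d d' dD dD' : ℤ}
    (h : ∀ j' j, d - e j + c j' j = d' - e' j')
    (hd : ∀ j, d - e j + (dD - eD j) = -(r + 1 : ℤ))
    (hd' : ∀ j', d' - e' j' + (dD' - eD' j') = -(r + 1 : ℤ))
    (ε : ((cech (fun _ : Unit => (0 : ℤ)) (⊤ : Submodule (P A r) (Unit → P A r))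
      (-(r + 1 : ℤ))).homology r) ≃ₗ[A] A)
    (Φ : ((cech e (⊤ : Submodule (P A r) (J → P A r)) d).homology r) ≃ₗ[A]
      Module.Dual A ((cech eD (⊤ : Submodule (P A r) (J → P A r)) dD).homology 0))
    (hΦ : ∀ ξ η, Φ ξ η = ε (dualPairing e r (fun j => dD - eD j) d (-(r + 1 : ℤ)) hd
      (globalSectionsEquivFree eD hr dD η) ξ))
    (Φ' : ((cech e' (⊤ : Submodule (P A r) (J' → P A r)) d').homology r) ≃ₗ[A]
      Module.Dual A ((cech eD' (⊤ : Submodule (P A r) (J' → P A r)) dD').homology 0))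
    (hΦ' : ∀ ξ' η', Φ' ξ' η' = ε (dualPairing e' r (fun j' => dD' - eD' j') d' (-(r + 1 : ℤ)) hd'
      (globalSectionsEquivFree eD' hr dD' η') ξ'))
    (ξ : (cech e (⊤ : Submodule (P A r) (J → P A r)) d).homology r)
    (η' : (cech eD' (⊤ : Submodule (P A r) (J' → P A r)) dD').homology 0) :
    Φ' ((HomologicalComplex.homologyMap (matMap e e' q hq d d' h) r).hom ξ) η' =
      Φ ξ ((HomologicalComplex.homologyMap (matMap eD' eD (fun j j' => q j' j)
        (fun j j' => hq j' j) dD' dD (transpose_degree_cond e e' eD eD' h hd hd')) 0).hom η') := by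
  rw [hΦ', hΦ, dualPairing_homologyMap_matMap (c' := fun j' => dD' - eD' j')
    (c'' := fun j => dD - eD j) e e' r q hq h hd' (globalSectionsEquivFree eD' hr dD' η')
    (fun j' j => transpose_degree_cond e e' eD eD' h hd hd' j j') hd]
  congr 1
  refine congrArg (fun g => dualPairing e r (fun j => dD - eD j) d (-(r + 1 : ℤ)) hd g ξ) ?_
  funext j
  apply Subtype.ext
  rw [coe_globalSectionsEquivFree_homologyMap_matMap]
  exact Finset.sum_congr rfl fun j' _ => mul_comm _ _

/-- **Serre duality in degree `0` is natural**: with `M`, `Mᵗ`, `ε` as in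
`serreDuality_top_naturality` and `Φ⁰ : H⁰(𝓕) ≃ Dual_A H^r(𝓕^∨ ⊗ ω)`,
`Φ⁰' : H⁰(𝓕') ≃ Dual_A H^r(𝓕'^∨ ⊗ ω)` characterised by the adjoint formulas of
`LaurentCechSerreDuality.exists_linearEquiv_dual_zero` ("for `i = 0` … the one induced by the
pairing of (b)"): for all `ξ ∈ H⁰(𝓕)`, `η̃' ∈ H^r(𝓕'^∨ ⊗ ω)`,
`Φ⁰' (H⁰(M) ξ) η̃' = Φ⁰ ξ (H^r(Mᵗ) η̃')`.
[cite: Hartshorne1977, III Thm. 7.1 (c) (pp. 239–240)] [cite: Hartshorne1977, III Cor. 7.7 (p. 244)] -/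
theorem serreDuality_zero_naturality (hr : 1 ≤ r) {c : J' → J → ℤ} (q : J' → J → P A r)
    (hq : ∀ j' j, toL A r (q j' j) ∈ Ldeg A r (c j' j)) {d d' dD dD' : ℤ}
    (h : ∀ j' j, d - e j + c j' j = d' - e' j')
    (hd : ∀ j, dD - eD j + (d - e j) = -(r + 1 : ℤ))
    (hd' : ∀ j', dD' - eD' j' + (d' - e' j') = -(r + 1 : ℤ))
    (ε : ((cech (fun _ : Unit => (0 : ℤ)) (⊤ : Submodule (P A r) (Unit → P A r))
      (-(r + 1 : ℤ))).homology r) ≃ₗ[A] A)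
    (Φ : ((cech e (⊤ : Submodule (P A r) (J → P A r)) d).homology 0) ≃ₗ[A]
      Module.Dual A ((cech eD (⊤ : Submodule (P A r) (J → P A r)) dD).homology r))
    (hΦ : ∀ ξ η, Φ ξ η = ε (dualPairing eD r (fun j => d - e j) dD (-(r + 1 : ℤ)) hd
      (globalSectionsEquivFree e hr d ξ) η))
    (Φ' : ((cech e' (⊤ : Submodule (P A r) (J' → P A r)) d').homology 0) ≃ₗ[A]
      Module.Dual A ((cech eD' (⊤ : Submodule (P A r) (J' → P A r)) dD').homology r))
    (hΦ' : ∀ ξ' η', Φ' ξ' η' = ε (dualPairing eD' r (fun j' => d' - e' j') dD' (-(r + 1 : ℤ)) hd'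
      (globalSectionsEquivFree e' hr d' ξ') η'))
    (ξ : (cech e (⊤ : Submodule (P A r) (J → P A r)) d).homology 0)
    (η' : (cech eD' (⊤ : Submodule (P A r) (J' → P A r)) dD').homology r) :
    Φ' ((HomologicalComplex.homologyMap (matMap e e' q hq d d' h) 0).hom ξ) η' =
      Φ ξ ((HomologicalComplex.homologyMap (matMap eD' eD (fun j j' => q j' j)
        (fun j j' => hq j' j) dD' dD (transpose_degree_cond' e e' eD eD' h hd hd')) r).hom η') := by
  rw [hΦ', hΦ, dualPairing_homologyMap_matMap (c' := fun j => d - e j)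
    (c'' := fun j' => d' - e' j') eD' eD r (fun j j' => q j' j) (fun j j' => hq j' j)
    (transpose_degree_cond' e e' eD eD' h hd hd') hd (globalSectionsEquivFree e hr d ξ)
    (fun j j' => h j' j) hd']
  congr 1
  refine congrArg (fun g => dualPairing eD' r (fun j' => d' - e' j') dD' (-(r + 1 : ℤ)) hd' g η') ?_
  funext j'
  apply Subtype.ext
  rw [coe_globalSectionsEquivFree_homologyMap_matMap]
  exact Finset.sum_congr rfl fun j _ => mul_comm _ _

end Naturality

/-! ### Line bundles: the duality commutes with multiplication by homogeneous polynomials -/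

section Twist

/-- **Degree `r`, line bundles**: a homomorphism `𝒪(d) → 𝒪(d + a)` is a homogeneous polynomial
`p` of degree `a`, acting on `H^r` and on `H⁰` by `mulPairing`; for the duality isomorphisms
`Φ : H^r(Č_d(P)) ≃ Dual_A H⁰(Č_c(P))` (`d + c = -r-1`) and
`Φ' : H^r(Č_{d+a}(P)) ≃ Dual_A H⁰(Č_{c-a}(P))` characterised through the cup product as in
`LaurentCechSerreDuality.exists_linearEquiv_dual_twist_top` (one fixed `ε`):
`Φ' (p · η) ξ' = Φ η (p · ξ')` for `η ∈ H^r(Č_d(P))`, `ξ' ∈ H⁰(Č_{c-a}(P))` (`r ≥ 1`).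
[cite: GortzWedhorn2023, Cor. 22.23] [cite: Hartshorne1977, III Thm. 7.1 (c) (pp. 239–240)] -/
theorem serreDuality_twist_top_naturality (hr : 1 ≤ r) {a c d c' d' : ℤ}
    (h : d + c = -(r + 1 : ℤ)) (h' : d' + c' = -(r + 1 : ℤ)) (hd : d + a = d') (hc : c' + a = c)
    (p : (Ldeg A r a).comap (toL A r).toLinearMap)
    (ε : ((cech (fun _ : Unit => (0 : ℤ)) (⊤ : Submodule (P A r) (Unit → P A r))
      (-(r + 1 : ℤ))).homology r) ≃ₗ[A] A)
    (Φ : ((cech (fun _ : Unit => (0 : ℤ)) (⊤ : Submodule (P A r) (Unit → P A r)) d).homology r)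
      ≃ₗ[A] Module.Dual A ((cech (fun _ : Unit => (0 : ℤ))
        (⊤ : Submodule (P A r) (Unit → P A r)) c).homology 0))
    (hΦ : ∀ η ξ, Φ η ξ = ε (cupPairing (fun _ : Unit => (0 : ℤ))
      (⊤ : Submodule (P A r) (Unit → P A r)) hr r c d (-(r + 1 : ℤ)) h ξ η))
    (Φ' : ((cech (fun _ : Unit => (0 : ℤ)) (⊤ : Submodule (P A r) (Unit → P A r)) d').homology r)
      ≃ₗ[A] Module.Dual A ((cech (fun _ : Unit => (0 : ℤ))
        (⊤ : Submodule (P A r) (Unit → P A r)) c').homology 0))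
    (hΦ' : ∀ η ξ, Φ' η ξ = ε (cupPairing (fun _ : Unit => (0 : ℤ))
      (⊤ : Submodule (P A r) (Unit → P A r)) hr r c' d' (-(r + 1 : ℤ)) h' ξ η))
    (η : (cech (fun _ : Unit => (0 : ℤ)) (⊤ : Submodule (P A r) (Unit → P A r)) d).homology r)
    (ξ' : (cech (fun _ : Unit => (0 : ℤ)) (⊤ : Submodule (P A r) (Unit → P A r)) c').homology 0) :
    Φ' (mulPairing (fun _ : Unit => (0 : ℤ)) (⊤ : Submodule (P A r) (Unit → P A r)) r a d d' hd
        p η) ξ' =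
      Φ η (mulPairing (fun _ : Unit => (0 : ℤ)) (⊤ : Submodule (P A r) (Unit → P A r)) 0 a c' c
        hc p ξ') := by
  rw [hΦ', hΦ, cupPairing_apply, cupPairing_apply]
  have hmem : (globalSectionsEquiv (A := A) hr c' ξ').1 * p.1 ∈
      (Ldeg A r c).comap (toL A r).toLinearMap := by
    have := toL_mul_mem_Ldeg (globalSectionsEquiv (A := A) hr c' ξ').2 p.2
    rwa [hc] at this
  have hprod : globalSectionsEquiv (A := A) hr c (mulPairing (fun _ : Unit => (0 : ℤ))
      (⊤ : Submodule (P A r) (Unit → P A r)) 0 a c' c hc p ξ') =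
      ⟨(globalSectionsEquiv (A := A) hr c' ξ').1 * p.1, hmem⟩ :=
    Subtype.ext (by rw [globalSectionsEquiv_mulPairing, mul_comm])
  rw [hprod]
  congr 1
  exact (mulPairing_mul (fun _ : Unit => (0 : ℤ)) (⊤ : Submodule (P A r) (Unit → P A r)) hc r
    (globalSectionsEquiv (A := A) hr c' ξ') p hmem hd h' h η).symm

/-- **Degree `0`, line bundles**: for the duality isomorphisms `Φ⁰ : H⁰(Č_c(P)) ≃ Dual_A H^r(Č_d(P))`
(`d + c = -r-1`) and `Φ⁰' : H⁰(Č_{c+a}(P)) ≃ Dual_A H^r(Č_{d-a}(P))` characterised through the cup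
product as in `LaurentCechSerreDuality.exists_linearEquiv_dual_twist_zero`, and a homogeneous
polynomial `p` of degree `a` (a homomorphism `𝒪(c) → 𝒪(c + a)`, resp. `𝒪(d - a) → 𝒪(d)`):
`Φ⁰' (p · ξ) η' = Φ⁰ ξ (p · η')` (`r ≥ 1`).
[cite: GortzWedhorn2023, Cor. 22.23] [cite: Hartshorne1977, III Thm. 7.1 (c) (pp. 239–240)] -/
theorem serreDuality_twist_zero_naturality (hr : 1 ≤ r) {a c d c' d' : ℤ}
    (h : d + c = -(r + 1 : ℤ)) (h' : d' + c' = -(r + 1 : ℤ)) (hc : c + a = c') (hd : d' + a = d)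
    (p : (Ldeg A r a).comap (toL A r).toLinearMap)
    (ε : ((cech (fun _ : Unit => (0 : ℤ)) (⊤ : Submodule (P A r) (Unit → P A r))
      (-(r + 1 : ℤ))).homology r) ≃ₗ[A] A)
    (Φ : ((cech (fun _ : Unit => (0 : ℤ)) (⊤ : Submodule (P A r) (Unit → P A r)) c).homology 0)
      ≃ₗ[A] Module.Dual A ((cech (fun _ : Unit => (0 : ℤ))
        (⊤ : Submodule (P A r) (Unit → P A r)) d).homology r))
    (hΦ : ∀ ξ η, Φ ξ η = ε (cupPairing (fun _ : Unit => (0 : ℤ))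
      (⊤ : Submodule (P A r) (Unit → P A r)) hr r c d (-(r + 1 : ℤ)) h ξ η))
    (Φ' : ((cech (fun _ : Unit => (0 : ℤ)) (⊤ : Submodule (P A r) (Unit → P A r)) c').homology 0)
      ≃ₗ[A] Module.Dual A ((cech (fun _ : Unit => (0 : ℤ))
        (⊤ : Submodule (P A r) (Unit → P A r)) d').homology r))
    (hΦ' : ∀ ξ η, Φ' ξ η = ε (cupPairing (fun _ : Unit => (0 : ℤ))
      (⊤ : Submodule (P A r) (Unit → P A r)) hr r c' d' (-(r + 1 : ℤ)) h' ξ η))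
    (ξ : (cech (fun _ : Unit => (0 : ℤ)) (⊤ : Submodule (P A r) (Unit → P A r)) c).homology 0)
    (η' : (cech (fun _ : Unit => (0 : ℤ)) (⊤ : Submodule (P A r) (Unit → P A r)) d').homology r) :
    Φ' (mulPairing (fun _ : Unit => (0 : ℤ)) (⊤ : Submodule (P A r) (Unit → P A r)) 0 a c c' hc
        p ξ) η' =
      Φ ξ (mulPairing (fun _ : Unit => (0 : ℤ)) (⊤ : Submodule (P A r) (Unit → P A r)) r a d' d
        hd p η') := by
  rw [hΦ', hΦ, cupPairing_apply, cupPairing_apply]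
  have hmem : (globalSectionsEquiv (A := A) hr c ξ).1 * p.1 ∈
      (Ldeg A r c').comap (toL A r).toLinearMap := by
    have := toL_mul_mem_Ldeg (globalSectionsEquiv (A := A) hr c ξ).2 p.2
    rwa [hc] at this
  have hprod : globalSectionsEquiv (A := A) hr c' (mulPairing (fun _ : Unit => (0 : ℤ))
      (⊤ : Submodule (P A r) (Unit → P A r)) 0 a c c' hc p ξ) =
      ⟨(globalSectionsEquiv (A := A) hr c ξ).1 * p.1, hmem⟩ :=
    Subtype.ext (by rw [globalSectionsEquiv_mulPairing, mul_comm])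
  rw [hprod]
  congr 1
  exact mulPairing_mul (fun _ : Unit => (0 : ℤ)) (⊤ : Submodule (P A r) (Unit → P A r)) hc r
    (globalSectionsEquiv (A := A) hr c ξ) p hmem hd h h' η'

end Twist

end LaurentCech

end Literature.Algebra.Homology

end
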